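import Mathlib
import Summits.NavierStokesRegularity.NavierStokesRegularity.Theorems.IntenseSetDoorsAssemblyCalm
import HarnessLib

/-!
# Crux `EulerZoomLiouville.PowerGaugeEulerLiouville` (stmt-NavierStokesRegularity-19832), width sub-line `chiral_anchor` (ns-idea-11 g10, REV3),
# stub K4 `stub_anchorRace` (THE RACE) — part (c): THE EXPONENT COUNT (real analysis only)

Seat ns-ezl-w3 g8 (`--supports stmt-NavierStokesRegularity-19832 --as helper`).  The bookkeeping of the race on dyadic shells `Q_j = 2^j A`:
* `ChiralAnchor.le_farVolumeBar` — the far-volume inequality `x^{1/6}(Q_j − R) ≤ C s (√τ Q_j^{(1−ρ)/2} + τ Q_j^{−(1/2+ρ)})` on the window (`τ ≤ A²`,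
  `R ≤ A`, `A ≥ 1`, `j ≥ 1`) gives `x ≤ V̄_j = (4 C s₁ Q_j^{(1−ρ)/2} 2^{−j})^6` for any `s₁ ≥ s`;
* `ChiralAnchor.div_min_le`, `rpow_six_twoThirds` (+ the tree's `IntenseSetDoors.pow_six_rpow_third`) — arithmetic;
* `ChiralAnchor.shellTerm_le` — the hosting cost of shell `j ≥ 1`, `M_j / e_j ≤ (K₃ (j+1)(j+2) x^j + K₄ ((j+1)(j+2))² z^j) A^{2−2ρ}` with `x = 2^{−2ρ}`,
  `z = 2^{−2−2ρ}`; `ChiralAnchor.coreTerm_le` — the core cost `M_0/e_0 ≤ K₁ A^{1−ρ} + K₂`;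
* `ChiralAnchor.summable_weightSq_geometric` — `Σ (j+1)(j+2) x^j`, `Σ ((j+1)(j+2))² z^j` converge (`|x|,|z| < 1`);
* `ChiralAnchor.exists_large_scale` — a scale `A ≥ max(1, R, √t)` with `K₁ A^{1−ρ} + K₂ + K₅ A^{2−2ρ} < A²` exists (`ρ > 0`).

HONEST FRAMING: arithmetic for one stub of a width sub-line of the MODEL-lattice crux class; nothing about the crux E (19832 OPEN) or NS; not E. [folklore]
-/

noncomputable section

set_option linter.dupNamespace false

open Set Filter Topology
open scoped Topology

namespace Summit.NavierStokesRegularity.NavierStokesRegularity.Theorems.PowerGaugeEulerLiouville.ChiralAnchor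

/-- `M/min(x,y) ≤ M/x + M/y` for `M ≥ 0`, `x, y > 0`. [folklore] -/
theorem div_min_le {M x y : ℝ} (hM : 0 ≤ M) (hx : 0 < x) (hy : 0 < y) : M / min x y ≤ M / x + M / y := by
  rcases le_total x y with h | h
  · rw [min_eq_left h]; linarith [div_nonneg hM hy.le]
  · rw [min_eq_right h]; linarith [div_nonneg hM hx.le]

/-- `(y⁶)^{2/3} = y⁴` for `y ≥ 0`. [folklore] -/
theorem rpow_six_twoThirds {y : ℝ} (hy : 0 ≤ y) : (y ^ 6) ^ (2 / 3 : ℝ) = y ^ 4 := by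
  rw [← Real.rpow_natCast y 6, ← Real.rpow_mul hy, ← Real.rpow_natCast y 4]; norm_num

/-- `(2^j : ℝ) = 2^{(j : ℝ)}`. -/
theorem two_pow_eq_rpow (j : ℕ) : ((2 : ℝ) ^ j : ℝ) = (2 : ℝ) ^ (j : ℝ) := (Real.rpow_natCast 2 j).symm

/-- **Far volume on the window**: from `x^{1/6}(2^jA − R) ≤ C s (√τ (2^jA)^{(1−ρ)/2} + τ (2^jA)^{−(1/2+ρ)})` with `0 ≤ x`, `1 ≤ A`, `R ≤ A`, `j ≥ 1`,
`τ ≤ A²`, `0 ≤ s ≤ s₁`, `0 ≤ C`, `0 ≤ ρ`: `x ≤ (4 C s₁ (2^jA)^{(1−ρ)/2} (2^j)⁻¹)^6`. [folklore] -/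
theorem le_farVolumeBar {x A R C s s₁ τ ρ : ℝ} {j : ℕ} (hx : 0 ≤ x) (hA : 1 ≤ A) (hRA : R ≤ A) (hj : 1 ≤ j)
    (hτA : τ ≤ A ^ 2) (hs : 0 ≤ s) (hs₁ : s ≤ s₁) (hC : 0 ≤ C) (hρ : 0 ≤ ρ)
    (h : x ^ (1 / 6 : ℝ) * (2 ^ j * A - R) ≤ C * s * (Real.sqrt τ * (2 ^ j * A) ^ ((1 - ρ) / 2) + τ * (2 ^ j * A) ^ (-(1 / 2 + ρ)))) :
    x ≤ (4 * C * s₁ * (2 ^ j * A) ^ ((1 - ρ) / 2) * (2 ^ j)⁻¹) ^ 6 := by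
  have hA0 : 0 < A := lt_of_lt_of_le one_pos hA
  have h2j : (2 : ℝ) ≤ 2 ^ j := by
    calc (2 : ℝ) = 2 ^ 1 := (pow_one _).symm
      _ ≤ 2 ^ j := pow_le_pow_right₀ one_le_two hj
  set Q : ℝ := 2 ^ j * A with hQ
  have hQA : 2 * A ≤ Q := by rw [hQ]; exact mul_le_mul_of_nonneg_right h2j hA0.le
  have hQ1 : 1 ≤ Q := by linarith
  have hQ0 : 0 < Q := by linarith
  have hQρ : 0 ≤ Q ^ ((1 - ρ) / 2) := Real.rpow_nonneg hQ0.le _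
  -- `√τ ≤ A`, and the second far term is dominated by the first
  have hsqrt : Real.sqrt τ ≤ A := by
    rw [← Real.sqrt_sq hA0.le]; exact Real.sqrt_le_sqrt hτA
  have hdom : τ * Q ^ (-(1 / 2 + ρ)) ≤ A * Q ^ ((1 - ρ) / 2) := by
    have h1 : τ * Q ^ (-(1 / 2 + ρ)) ≤ A ^ 2 * Q ^ (-(1 / 2 + ρ)) :=
      mul_le_mul_of_nonneg_right hτA (Real.rpow_nonneg hQ0.le _)
    have h2 : A ^ 2 * Q ^ (-(1 / 2 + ρ)) = A * Q ^ ((1 - ρ) / 2) * (A * Q ^ (-(1 + ρ / 2))) := by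
      have : Q ^ (-(1 / 2 + ρ)) = Q ^ ((1 - ρ) / 2) * Q ^ (-(1 + ρ / 2)) := by
        rw [← Real.rpow_add hQ0]; congr 1; ring
      rw [this]; ring
    have h3 : A * Q ^ (-(1 + ρ / 2)) ≤ 1 := by
      have h4 : Q ^ (-(1 + ρ / 2)) ≤ Q ^ (-(1 : ℝ)) :=
        Real.rpow_le_rpow_of_exponent_le hQ1 (by linarith)
      rw [Real.rpow_neg_one] at h4
      calc A * Q ^ (-(1 + ρ / 2)) ≤ A * Q⁻¹ := mul_le_mul_of_nonneg_left h4 hA0.le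
        _ ≤ 1 := by rw [mul_inv_le_iff₀ hQ0]; linarith
    calc τ * Q ^ (-(1 / 2 + ρ)) ≤ A ^ 2 * Q ^ (-(1 / 2 + ρ)) := h1
      _ = A * Q ^ ((1 - ρ) / 2) * (A * Q ^ (-(1 + ρ / 2))) := h2
      _ ≤ A * Q ^ ((1 - ρ) / 2) * 1 := mul_le_mul_of_nonneg_left h3 (by positivity)
      _ = A * Q ^ ((1 - ρ) / 2) := mul_one _
  have hrhs : C * s * (Real.sqrt τ * Q ^ ((1 - ρ) / 2) + τ * Q ^ (-(1 / 2 + ρ))) ≤ 2 * C * s₁ * A * Q ^ ((1 - ρ) / 2) := by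
    have h1 : Real.sqrt τ * Q ^ ((1 - ρ) / 2) + τ * Q ^ (-(1 / 2 + ρ)) ≤ 2 * (A * Q ^ ((1 - ρ) / 2)) := by
      have := mul_le_mul_of_nonneg_right hsqrt hQρ
      linarith
    have h0 : 0 ≤ 2 * (A * Q ^ ((1 - ρ) / 2)) := by positivity
    calc C * s * (Real.sqrt τ * Q ^ ((1 - ρ) / 2) + τ * Q ^ (-(1 / 2 + ρ)))
        ≤ C * s * (2 * (A * Q ^ ((1 - ρ) / 2))) := mul_le_mul_of_nonneg_left h1 (mul_nonneg hC hs)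
      _ ≤ C * s₁ * (2 * (A * Q ^ ((1 - ρ) / 2))) :=
          mul_le_mul_of_nonneg_right (mul_le_mul_of_nonneg_left hs₁ hC) h0
      _ = 2 * C * s₁ * A * Q ^ ((1 - ρ) / 2) := by ring
  -- `Q − R ≥ Q/2`
  have hQR : Q / 2 ≤ Q - R := by linarith
  have hx6 : 0 ≤ x ^ (1 / 6 : ℝ) := Real.rpow_nonneg hx _
  have hkey : x ^ (1 / 6 : ℝ) * (Q / 2) ≤ 2 * C * s * 0 + 2 * C * s₁ * A * Q ^ ((1 - ρ) / 2) := by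
    calc x ^ (1 / 6 : ℝ) * (Q / 2) ≤ x ^ (1 / 6 : ℝ) * (Q - R) := mul_le_mul_of_nonneg_left hQR hx6
      _ ≤ _ := h.trans (by linarith [hrhs])
  have hy : x ^ (1 / 6 : ℝ) ≤ 4 * C * s₁ * Q ^ ((1 - ρ) / 2) * (2 ^ j)⁻¹ := by
    rw [mul_zero, zero_add] at hkey
    have : x ^ (1 / 6 : ℝ) ≤ 2 * C * s₁ * A * Q ^ ((1 - ρ) / 2) / (Q / 2) := by
      rw [le_div_iff₀ (by positivity)]; exact hkey
    refine this.trans (le_of_eq ?_)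
    rw [hQ]; field_simp; ring
  have hy0 : 0 ≤ 4 * C * s₁ * Q ^ ((1 - ρ) / 2) * (2 ^ j)⁻¹ := by
    have : 0 ≤ s₁ := hs.trans hs₁
    positivity
  calc x = (x ^ (1 / 6 : ℝ)) ^ 6 := by
        rw [← Real.rpow_natCast (x ^ (1 / 6 : ℝ)) 6, ← Real.rpow_mul hx]; norm_num
    _ ≤ (4 * C * s₁ * Q ^ ((1 - ρ) / 2) * (2 ^ j)⁻¹) ^ 6 := pow_le_pow_left₀ hx6 hy 6

/-- **Cost of a hosting SHELL** (`j ≥ 1`, `Q = 2^jA`, outer radius `2Q`, `V̄ = (4 C_V s₁ Q^{(1−ρ)/2} 2^{−j})^6`):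
`c (2Q)^{1−ρ} / min(wH/(2Cκ V̄^{1/3}), (wH)²(2Q)^{1+2ρ}/(4C²κ²c₁V̄^{2/3})) ≤ (K₃ (j+1)(j+2) x^j + K₄ ((j+1)(j+2))² z^j) A^{2−2ρ}`,
`w = ((j+1)(j+2))⁻¹`, `x = 2^{−2ρ}`, `z = 2^{−2−2ρ}`, `K₃ = 64 C κ C_V² s₁² c / H`, `K₄ = 1024 C² κ² C_V⁴ s₁⁴ c c₁ / H²`. [folklore] -/
theorem shellTerm_le {C κ CV s₁ c c₁ H A ρ : ℝ} {j : ℕ} (hC : 0 < C) (hκ : 0 < κ) (hCV : 0 < CV) (hs₁ : 0 < s₁) (hc : 0 ≤ c)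
    (hc₁ : 0 < c₁) (hH : 0 < H) (hA : 1 ≤ A) (hρ : 0 < ρ) (hj : 1 ≤ j) :
    c * (2 * (2 ^ j * A)) ^ (1 - ρ) /
        min ((((j : ℝ) + 1) * ((j : ℝ) + 2))⁻¹ * H / (2 * C * κ * ((4 * CV * s₁ * (2 ^ j * A) ^ ((1 - ρ) / 2) * (2 ^ j)⁻¹) ^ 6) ^ (1 / 3 : ℝ)))
          (((((j : ℝ) + 1) * ((j : ℝ) + 2))⁻¹ * H) ^ 2 * (2 * (2 ^ j * A)) ^ (1 + 2 * ρ) /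
            (4 * C ^ 2 * κ ^ 2 * c₁ * ((4 * CV * s₁ * (2 ^ j * A) ^ ((1 - ρ) / 2) * (2 ^ j)⁻¹) ^ 6) ^ (2 / 3 : ℝ))) ≤
      (64 * C * κ * CV ^ 2 * s₁ ^ 2 * c / H * (((j : ℝ) + 1) * ((j : ℝ) + 2)) * ((2 : ℝ) ^ (-2 * ρ)) ^ j +
          1024 * C ^ 2 * κ ^ 2 * CV ^ 4 * s₁ ^ 4 * c * c₁ / H ^ 2 * (((j : ℝ) + 1) * ((j : ℝ) + 2)) ^ 2 *
            ((2 : ℝ) ^ (-2 - 2 * ρ)) ^ j) * A ^ (2 - 2 * ρ) := by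
  have hA0 : 0 < A := lt_of_lt_of_le one_pos hA
  set Q : ℝ := 2 ^ j * A with hQ
  have h2j0 : (0 : ℝ) < 2 ^ j := by positivity
  have h2j : (2 : ℝ) ≤ 2 ^ j := by
    calc (2 : ℝ) = 2 ^ 1 := (pow_one _).symm
      _ ≤ 2 ^ j := pow_le_pow_right₀ one_le_two hj
  have hQ0 : 0 < Q := by positivity
  have hQ1 : 1 ≤ 2 * Q := by
    have : 2 * A ≤ Q := by rw [hQ]; exact mul_le_mul_of_nonneg_right h2j hA0.le
    linarith
  set y : ℝ := 4 * CV * s₁ * Q ^ ((1 - ρ) / 2) * (2 ^ j)⁻¹ with hy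
  have hy0 : 0 < y := by positivity
  have hw : 0 < (((j : ℝ) + 1) * ((j : ℝ) + 2))⁻¹ := by positivity
  rw [IntenseSetDoors.pow_six_rpow_third hy0.le, rpow_six_twoThirds hy0.le]
  have hX1 : 0 < (((j : ℝ) + 1) * ((j : ℝ) + 2))⁻¹ * H / (2 * C * κ * y ^ 2) := by positivity
  have hX2 : 0 < ((((j : ℝ) + 1) * ((j : ℝ) + 2))⁻¹ * H) ^ 2 * (2 * Q) ^ (1 + 2 * ρ) / (4 * C ^ 2 * κ ^ 2 * c₁ * y ^ 4) := by
    have : 0 < (2 * Q) ^ (1 + 2 * ρ) := Real.rpow_pos_of_pos (by positivity) _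
    positivity
  have hM : 0 ≤ c * (2 * Q) ^ (1 - ρ) := mul_nonneg hc (Real.rpow_nonneg (by positivity) _)
  refine (div_min_le hM hX1 hX2).trans ?_
  -- exponent bookkeeping: everything is a power of `2` times a power of `A`
  have e2j : ((2 : ℝ) ^ j : ℝ) = (2 : ℝ) ^ (j : ℝ) := two_pow_eq_rpow j
  have hQr : ∀ r : ℝ, Q ^ r = (2 : ℝ) ^ ((j : ℝ) * r) * A ^ r := fun r => by
    rw [hQ, Real.mul_rpow h2j0.le hA0.le, e2j, ← Real.rpow_mul (by norm_num : (0 : ℝ) ≤ 2)]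
  -- the two power identities
  have hT0 : (0 : ℝ) < 2 ^ j := h2j0
  have hxj : ((2 : ℝ) ^ (-2 * ρ)) ^ j = ((2 : ℝ) ^ j) ^ (-2 * ρ) := by
    rw [← Real.rpow_mul_natCast (by norm_num : (0 : ℝ) ≤ 2), e2j, ← Real.rpow_mul (by norm_num : (0 : ℝ) ≤ 2), mul_comm]
  have hzj : ((2 : ℝ) ^ (-2 - 2 * ρ)) ^ j = ((2 : ℝ) ^ j) ^ (-2 - 2 * ρ) := by
    rw [← Real.rpow_mul_natCast (by norm_num : (0 : ℝ) ≤ 2), e2j, ← Real.rpow_mul (by norm_num : (0 : ℝ) ≤ 2), mul_comm]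
  have hA2 : A ^ (1 - ρ) * A ^ (1 - ρ) = A ^ (2 - 2 * ρ) := by
    rw [← Real.rpow_add hA0]; congr 1; ring
  have hTinv2 : ((2 ^ j : ℝ)⁻¹) ^ 2 = ((2 : ℝ) ^ j) ^ (-2 : ℝ) := by
    rw [inv_pow, ← Real.rpow_natCast ((2 : ℝ) ^ j) 2, ← Real.rpow_neg hT0.le]; norm_num
  have hTinv4 : ((2 ^ j : ℝ)⁻¹) ^ 4 = ((2 : ℝ) ^ j) ^ (-4 : ℝ) := by
    rw [inv_pow, ← Real.rpow_natCast ((2 : ℝ) ^ j) 4, ← Real.rpow_neg hT0.le]; norm_num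
  have hy2Q : (Q ^ ((1 - ρ) / 2)) ^ 2 = Q ^ (1 - ρ) := by
    rw [← Real.rpow_mul_natCast hQ0.le]; congr 1; push_cast; ring
  have hy4Q : (Q ^ ((1 - ρ) / 2)) ^ 4 = Q ^ (2 - 2 * ρ) := by
    rw [← Real.rpow_mul_natCast hQ0.le]; congr 1; push_cast; ring
  have hQ1r : Q ^ (1 - ρ) = (2 ^ j) ^ (1 - ρ) * A ^ (1 - ρ) := by rw [hQ, Real.mul_rpow hT0.le hA0.le]
  have hQ2r : Q ^ (2 - 2 * ρ) = (2 ^ j) ^ (2 - 2 * ρ) * A ^ (2 - 2 * ρ) := by rw [hQ, Real.mul_rpow hT0.le hA0.le]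
  have h2Q1r : (2 * Q) ^ (1 - ρ) = 2 ^ (1 - ρ) * ((2 ^ j) ^ (1 - ρ) * A ^ (1 - ρ)) := by
    rw [Real.mul_rpow (by norm_num : (0 : ℝ) ≤ 2) hQ0.le, hQ1r]
  have key1 : (2 * Q) ^ (1 - ρ) * (Q ^ ((1 - ρ) / 2)) ^ 2 * ((2 ^ j : ℝ)⁻¹) ^ 2 =
      2 ^ (1 - ρ) * ((2 : ℝ) ^ (-2 * ρ)) ^ j * A ^ (2 - 2 * ρ) := by
    have hT : ((2 : ℝ) ^ j) ^ (1 - ρ) * ((2 : ℝ) ^ j) ^ (1 - ρ) * ((2 : ℝ) ^ j) ^ (-2 : ℝ) = ((2 : ℝ) ^ j) ^ (-2 * ρ) := by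
      rw [← Real.rpow_add hT0, ← Real.rpow_add hT0]; congr 1; ring
    rw [hy2Q, hTinv2, h2Q1r, hQ1r, hxj, ← hT, ← hA2]; ring
  have key2 : (2 * Q) ^ (1 - ρ) * (Q ^ ((1 - ρ) / 2)) ^ 4 * ((2 ^ j : ℝ)⁻¹) ^ 4 =
      (2 * Q) ^ (1 + 2 * ρ) * ((2 * Q) ^ (-3 * ρ) * (((2 : ℝ) ^ (-2 - 2 * ρ)) ^ j * A ^ (2 - 2 * ρ))) := by
    have hT : ((2 : ℝ) ^ j) ^ (2 - 2 * ρ) * ((2 : ℝ) ^ j) ^ (-4 : ℝ) = ((2 : ℝ) ^ j) ^ (-2 - 2 * ρ) := by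
      rw [← Real.rpow_add hT0]; congr 1; ring
    have h2Q : (2 * Q) ^ (1 - ρ) = (2 * Q) ^ (1 + 2 * ρ) * (2 * Q) ^ (-3 * ρ) := by
      rw [← Real.rpow_add (by positivity : (0 : ℝ) < 2 * Q)]; congr 1; ring
    rw [hy4Q, hTinv4, h2Q, hQ2r, hzj, ← hT]; ring
  -- the first term
  have hpoly : 0 < ((j : ℝ) + 1) * ((j : ℝ) + 2) := by positivity
  have h21 : (2 : ℝ) ^ (1 - ρ) ≤ 2 := by
    calc (2 : ℝ) ^ (1 - ρ) ≤ 2 ^ (1 : ℝ) := Real.rpow_le_rpow_of_exponent_le one_le_two (by linarith)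
      _ = 2 := Real.rpow_one _
  have hxj0 : 0 ≤ ((2 : ℝ) ^ (-2 * ρ)) ^ j := pow_nonneg (Real.rpow_nonneg (by norm_num) _) _
  have hzj0 : 0 ≤ ((2 : ℝ) ^ (-2 - 2 * ρ)) ^ j := pow_nonneg (Real.rpow_nonneg (by norm_num) _) _
  have hA22 : 0 ≤ A ^ (2 - 2 * ρ) := Real.rpow_nonneg hA0.le _
  have hterm1 : c * (2 * Q) ^ (1 - ρ) / ((((j : ℝ) + 1) * ((j : ℝ) + 2))⁻¹ * H / (2 * C * κ * y ^ 2)) ≤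
      64 * C * κ * CV ^ 2 * s₁ ^ 2 * c / H * (((j : ℝ) + 1) * ((j : ℝ) + 2)) * ((2 : ℝ) ^ (-2 * ρ)) ^ j * A ^ (2 - 2 * ρ) := by
    have heq : c * (2 * Q) ^ (1 - ρ) / ((((j : ℝ) + 1) * ((j : ℝ) + 2))⁻¹ * H / (2 * C * κ * y ^ 2)) =
        32 * C * κ * CV ^ 2 * s₁ ^ 2 * c / H * (((j : ℝ) + 1) * ((j : ℝ) + 2)) *
          ((2 * Q) ^ (1 - ρ) * (Q ^ ((1 - ρ) / 2)) ^ 2 * ((2 ^ j : ℝ)⁻¹) ^ 2) := by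
      rw [hy]; field_simp; ring
    rw [heq, key1]
    have hbase : 0 ≤ 32 * C * κ * CV ^ 2 * s₁ ^ 2 * c / H * (((j : ℝ) + 1) * ((j : ℝ) + 2)) := by positivity
    calc 32 * C * κ * CV ^ 2 * s₁ ^ 2 * c / H * (((j : ℝ) + 1) * ((j : ℝ) + 2)) *
          (2 ^ (1 - ρ) * ((2 : ℝ) ^ (-2 * ρ)) ^ j * A ^ (2 - 2 * ρ))
        = 32 * C * κ * CV ^ 2 * s₁ ^ 2 * c / H * (((j : ℝ) + 1) * ((j : ℝ) + 2)) * 2 ^ (1 - ρ) *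
            (((2 : ℝ) ^ (-2 * ρ)) ^ j * A ^ (2 - 2 * ρ)) := by ring
      _ ≤ 32 * C * κ * CV ^ 2 * s₁ ^ 2 * c / H * (((j : ℝ) + 1) * ((j : ℝ) + 2)) * 2 *
            (((2 : ℝ) ^ (-2 * ρ)) ^ j * A ^ (2 - 2 * ρ)) := by
          have := mul_nonneg hxj0 hA22
          gcongr
      _ = _ := by ring
  -- the second term
  have h2Q3 : (2 * Q) ^ (-3 * ρ) ≤ 1 :=
    Real.rpow_le_one_of_one_le_of_nonpos hQ1 (by linarith)
  have hterm2 : c * (2 * Q) ^ (1 - ρ) /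
      (((((j : ℝ) + 1) * ((j : ℝ) + 2))⁻¹ * H) ^ 2 * (2 * Q) ^ (1 + 2 * ρ) / (4 * C ^ 2 * κ ^ 2 * c₁ * y ^ 4)) ≤
      1024 * C ^ 2 * κ ^ 2 * CV ^ 4 * s₁ ^ 4 * c * c₁ / H ^ 2 * (((j : ℝ) + 1) * ((j : ℝ) + 2)) ^ 2 *
        ((2 : ℝ) ^ (-2 - 2 * ρ)) ^ j * A ^ (2 - 2 * ρ) := by
    have h2Qpos : 0 < (2 * Q) ^ (1 + 2 * ρ) := Real.rpow_pos_of_pos (by positivity) _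
    have heq : c * (2 * Q) ^ (1 - ρ) /
        (((((j : ℝ) + 1) * ((j : ℝ) + 2))⁻¹ * H) ^ 2 * (2 * Q) ^ (1 + 2 * ρ) / (4 * C ^ 2 * κ ^ 2 * c₁ * y ^ 4)) =
        1024 * C ^ 2 * κ ^ 2 * CV ^ 4 * s₁ ^ 4 * c * c₁ / H ^ 2 * (((j : ℝ) + 1) * ((j : ℝ) + 2)) ^ 2 *
          ((2 * Q) ^ (1 - ρ) * (Q ^ ((1 - ρ) / 2)) ^ 4 * ((2 ^ j : ℝ)⁻¹) ^ 4) / (2 * Q) ^ (1 + 2 * ρ) := by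
      rw [hy]; field_simp; ring
    rw [heq, key2, mul_div_assoc, mul_div_cancel_left₀ _ h2Qpos.ne']
    have hbase : 0 ≤ 1024 * C ^ 2 * κ ^ 2 * CV ^ 4 * s₁ ^ 4 * c * c₁ / H ^ 2 * (((j : ℝ) + 1) * ((j : ℝ) + 2)) ^ 2 := by
      positivity
    calc 1024 * C ^ 2 * κ ^ 2 * CV ^ 4 * s₁ ^ 4 * c * c₁ / H ^ 2 * (((j : ℝ) + 1) * ((j : ℝ) + 2)) ^ 2 *
          ((2 * Q) ^ (-3 * ρ) * (((2 : ℝ) ^ (-2 - 2 * ρ)) ^ j * A ^ (2 - 2 * ρ)))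
        ≤ 1024 * C ^ 2 * κ ^ 2 * CV ^ 4 * s₁ ^ 4 * c * c₁ / H ^ 2 * (((j : ℝ) + 1) * ((j : ℝ) + 2)) ^ 2 *
          (1 * (((2 : ℝ) ^ (-2 - 2 * ρ)) ^ j * A ^ (2 - 2 * ρ))) := by
          have := mul_nonneg hzj0 hA22
          gcongr
      _ = _ := by ring
  have hsplit : (64 * C * κ * CV ^ 2 * s₁ ^ 2 * c / H * (((j : ℝ) + 1) * ((j : ℝ) + 2)) * ((2 : ℝ) ^ (-2 * ρ)) ^ j +
          1024 * C ^ 2 * κ ^ 2 * CV ^ 4 * s₁ ^ 4 * c * c₁ / H ^ 2 * (((j : ℝ) + 1) * ((j : ℝ) + 2)) ^ 2 *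
            ((2 : ℝ) ^ (-2 - 2 * ρ)) ^ j) * A ^ (2 - 2 * ρ) =
      64 * C * κ * CV ^ 2 * s₁ ^ 2 * c / H * (((j : ℝ) + 1) * ((j : ℝ) + 2)) * ((2 : ℝ) ^ (-2 * ρ)) ^ j * A ^ (2 - 2 * ρ) +
        1024 * C ^ 2 * κ ^ 2 * CV ^ 4 * s₁ ^ 4 * c * c₁ / H ^ 2 * (((j : ℝ) + 1) * ((j : ℝ) + 2)) ^ 2 *
          ((2 : ℝ) ^ (-2 - 2 * ρ)) ^ j * A ^ (2 - 2 * ρ) := by ring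
  rw [hsplit]
  exact add_le_add hterm1 hterm2

/-- **Cost of the hosting CORE** (`j = 0`, ball `B(0,2A)`, `V̄ = v₁ > 0`):
`c (2A)^{1−ρ} / min(H/2/(2Cκ v₁^{1/3}), (H/2)² (2A)^{1+2ρ}/(4C²κ²c₁v₁^{2/3})) ≤ 8Cκ c v₁^{1/3}/H · A^{1−ρ} + 16 C²κ² c c₁ v₁^{2/3}/H²`. [folklore] -/
theorem coreTerm_le {C κ v₁ c c₁ H A ρ : ℝ} (hC : 0 < C) (hκ : 0 < κ) (hv₁ : 0 < v₁) (hc : 0 ≤ c) (hc₁ : 0 < c₁) (hH : 0 < H)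
    (hA : 1 ≤ A) (hρ : 0 < ρ) :
    c * (2 * A) ^ (1 - ρ) /
        min ((2 : ℝ)⁻¹ * H / (2 * C * κ * v₁ ^ (1 / 3 : ℝ)))
          (((2 : ℝ)⁻¹ * H) ^ 2 * (2 * A) ^ (1 + 2 * ρ) / (4 * C ^ 2 * κ ^ 2 * c₁ * v₁ ^ (2 / 3 : ℝ))) ≤
      8 * C * κ * c * v₁ ^ (1 / 3 : ℝ) / H * A ^ (1 - ρ) + 16 * C ^ 2 * κ ^ 2 * c * c₁ * v₁ ^ (2 / 3 : ℝ) / H ^ 2 := by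
  have hA0 : 0 < A := lt_of_lt_of_le one_pos hA
  have hv3 : 0 < v₁ ^ (1 / 3 : ℝ) := Real.rpow_pos_of_pos hv₁ _
  have hv23 : 0 < v₁ ^ (2 / 3 : ℝ) := Real.rpow_pos_of_pos hv₁ _
  have h2A1 : 1 ≤ 2 * A := by linarith
  have h2Apos : 0 < (2 * A) ^ (1 + 2 * ρ) := Real.rpow_pos_of_pos (by positivity) _
  have hX1 : 0 < (2 : ℝ)⁻¹ * H / (2 * C * κ * v₁ ^ (1 / 3 : ℝ)) := by positivity
  have hX2 : 0 < ((2 : ℝ)⁻¹ * H) ^ 2 * (2 * A) ^ (1 + 2 * ρ) / (4 * C ^ 2 * κ ^ 2 * c₁ * v₁ ^ (2 / 3 : ℝ)) := by positivity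
  have hM : 0 ≤ c * (2 * A) ^ (1 - ρ) := mul_nonneg hc (Real.rpow_nonneg (by positivity) _)
  refine (div_min_le hM hX1 hX2).trans (add_le_add ?_ ?_)
  · have heq : c * (2 * A) ^ (1 - ρ) / ((2 : ℝ)⁻¹ * H / (2 * C * κ * v₁ ^ (1 / 3 : ℝ))) =
        4 * C * κ * c * v₁ ^ (1 / 3 : ℝ) / H * (2 * A) ^ (1 - ρ) := by
      field_simp; ring
    have h2r : (2 * A) ^ (1 - ρ) ≤ 2 * A ^ (1 - ρ) := by
      rw [Real.mul_rpow (by norm_num) hA0.le]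
      have h21 : (2 : ℝ) ^ (1 - ρ) ≤ 2 := by
        calc (2 : ℝ) ^ (1 - ρ) ≤ 2 ^ (1 : ℝ) := Real.rpow_le_rpow_of_exponent_le one_le_two (by linarith)
          _ = 2 := Real.rpow_one _
      exact mul_le_mul_of_nonneg_right h21 (Real.rpow_nonneg hA0.le _)
    rw [heq]
    have hbase : 0 ≤ 4 * C * κ * c * v₁ ^ (1 / 3 : ℝ) / H := by positivity
    calc 4 * C * κ * c * v₁ ^ (1 / 3 : ℝ) / H * (2 * A) ^ (1 - ρ) ≤ 4 * C * κ * c * v₁ ^ (1 / 3 : ℝ) / H * (2 * A ^ (1 - ρ)) :=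
          mul_le_mul_of_nonneg_left h2r hbase
      _ = _ := by ring
  · have hsplit : (2 * A) ^ (1 - ρ) = (2 * A) ^ (1 + 2 * ρ) * (2 * A) ^ (-3 * ρ) := by
      rw [← Real.rpow_add (by positivity : (0 : ℝ) < 2 * A)]; congr 1; ring
    have heq : c * (2 * A) ^ (1 - ρ) / (((2 : ℝ)⁻¹ * H) ^ 2 * (2 * A) ^ (1 + 2 * ρ) / (4 * C ^ 2 * κ ^ 2 * c₁ * v₁ ^ (2 / 3 : ℝ))) =
        16 * C ^ 2 * κ ^ 2 * c * c₁ * v₁ ^ (2 / 3 : ℝ) / H ^ 2 * (2 * A) ^ (-3 * ρ) := by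
      rw [hsplit]; field_simp; ring
    have h3 : (2 * A) ^ (-3 * ρ) ≤ 1 := Real.rpow_le_one_of_one_le_of_nonpos h2A1 (by linarith)
    rw [heq]
    have hbase : 0 ≤ 16 * C ^ 2 * κ ^ 2 * c * c₁ * v₁ ^ (2 / 3 : ℝ) / H ^ 2 := by positivity
    calc 16 * C ^ 2 * κ ^ 2 * c * c₁ * v₁ ^ (2 / 3 : ℝ) / H ^ 2 * (2 * A) ^ (-3 * ρ)
        ≤ 16 * C ^ 2 * κ ^ 2 * c * c₁ * v₁ ^ (2 / 3 : ℝ) / H ^ 2 * 1 := mul_le_mul_of_nonneg_left h3 hbase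
      _ = _ := mul_one _

/-- `Σ_j (j+1)(j+2) x^j` and `Σ_j ((j+1)(j+2))² x^j` converge for `0 ≤ x < 1`. [folklore] -/
theorem summable_weightSq_geometric {x : ℝ} (hx0 : 0 ≤ x) (hx : x < 1) :
    Summable (fun j : ℕ => ((j : ℝ) + 1) * ((j : ℝ) + 2) * x ^ j) ∧
      Summable (fun j : ℕ => (((j : ℝ) + 1) * ((j : ℝ) + 2)) ^ 2 * x ^ j) := by
  have hn : ‖x‖ < 1 := by rw [Real.norm_of_nonneg hx0]; exact hx
  have hk : ∀ k : ℕ, Summable (fun j : ℕ => (j : ℝ) ^ k * x ^ j) := fun k => summable_pow_mul_geometric_of_norm_lt_one k hn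
  constructor
  · have : (fun j : ℕ => ((j : ℝ) + 1) * ((j : ℝ) + 2) * x ^ j) =
        fun j : ℕ => (j : ℝ) ^ 2 * x ^ j + 3 * ((j : ℝ) ^ 1 * x ^ j) + 2 * ((j : ℝ) ^ 0 * x ^ j) := by
      funext j; ring
    rw [this]
    exact ((hk 2).add ((hk 1).mul_left 3)).add ((hk 0).mul_left 2)
  · have : (fun j : ℕ => (((j : ℝ) + 1) * ((j : ℝ) + 2)) ^ 2 * x ^ j) =
        fun j : ℕ => (j : ℝ) ^ 4 * x ^ j + 6 * ((j : ℝ) ^ 3 * x ^ j) + 13 * ((j : ℝ) ^ 2 * x ^ j) +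
          12 * ((j : ℝ) ^ 1 * x ^ j) + 4 * ((j : ℝ) ^ 0 * x ^ j) := by
      funext j; ring
    rw [this]
    exact ((((hk 4).add ((hk 3).mul_left 6)).add ((hk 2).mul_left 13)).add ((hk 1).mul_left 12)).add ((hk 0).mul_left 4)

/-- **A large scale exists**: for `ρ > 0` and any `K₁ K₂ K₅ R t`, some `A ≥ 1` with `R ≤ A`, `t ≤ A²` and `K₁A^{1−ρ} + K₂ + K₅A^{2−2ρ} < A²`. [folklore] -/
theorem exists_large_scale {ρ : ℝ} (hρ : 0 < ρ) (K₁ K₂ K₅ R t : ℝ) :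
    ∃ A : ℝ, 1 ≤ A ∧ R ≤ A ∧ t ≤ A ^ 2 ∧ K₁ * A ^ (1 - ρ) + K₂ + K₅ * A ^ (2 - 2 * ρ) < A ^ 2 := by
  -- `f(A) = (K₁A^{1−ρ} + K₂ + K₅A^{2−2ρ}) / A² → 0`
  have hlim : Tendsto (fun A : ℝ => K₁ * A ^ (-(1 + ρ)) + K₂ * A ^ (-(2 : ℝ)) + K₅ * A ^ (-(2 * ρ))) atTop (𝓝 0) := by
    have h1 := (tendsto_rpow_neg_atTop (by linarith : 0 < 1 + ρ)).const_mul K₁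
    have h2 := (tendsto_rpow_neg_atTop (by norm_num : (0 : ℝ) < 2)).const_mul K₂
    have h3 := (tendsto_rpow_neg_atTop (by linarith : 0 < 2 * ρ)).const_mul K₅
    simpa using (h1.add h2).add h3
  have hev : ∀ᶠ A : ℝ in atTop, K₁ * A ^ (-(1 + ρ)) + K₂ * A ^ (-(2 : ℝ)) + K₅ * A ^ (-(2 * ρ)) < 1 :=
    hlim.eventually (gt_mem_nhds zero_lt_one)
  obtain ⟨A, hA⟩ := (((hev.and (eventually_ge_atTop 1)).and (eventually_ge_atTop R)).and
    (eventually_ge_atTop (Real.sqrt t))).exists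
  obtain ⟨⟨⟨hf, hA1⟩, hAR⟩, hAt⟩ := hA
  have hA0 : 0 < A := lt_of_lt_of_le one_pos hA1
  refine ⟨A, hA1, hAR, ?_, ?_⟩
  · calc t ≤ Real.sqrt t ^ 2 := by
          rcases le_or_gt 0 t with h | h
          · rw [Real.sq_sqrt h]
          · exact h.le.trans (sq_nonneg _)
      _ ≤ A ^ 2 := pow_le_pow_left₀ (Real.sqrt_nonneg _) hAt 2
  · have hA2 : 0 < A ^ 2 := by positivity
    have hmul := mul_lt_mul_of_pos_right hf hA2
    rw [one_mul] at hmul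
    refine lt_of_eq_of_lt ?_ hmul
    have e1 : A ^ (-(1 + ρ)) * A ^ 2 = A ^ (1 - ρ) := by
      rw [← Real.rpow_natCast A 2, ← Real.rpow_add hA0]; congr 1; push_cast; ring
    have e2 : A ^ (-(2 : ℝ)) * A ^ 2 = 1 := by
      rw [← Real.rpow_natCast A 2, ← Real.rpow_add hA0]; norm_num
    have e3 : A ^ (-(2 * ρ)) * A ^ 2 = A ^ (2 - 2 * ρ) := by
      rw [← Real.rpow_natCast A 2, ← Real.rpow_add hA0]; congr 1; push_cast; ring
    calc K₁ * A ^ (1 - ρ) + K₂ + K₅ * A ^ (2 - 2 * ρ)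
        = K₁ * (A ^ (-(1 + ρ)) * A ^ 2) + K₂ * (A ^ (-(2 : ℝ)) * A ^ 2) + K₅ * (A ^ (-(2 * ρ)) * A ^ 2) := by
          rw [e1, e2, e3, mul_one]
      _ = (K₁ * A ^ (-(1 + ρ)) + K₂ * A ^ (-(2 : ℝ)) + K₅ * A ^ (-(2 * ρ))) * A ^ 2 := by ring

end Summit.NavierStokesRegularity.NavierStokesRegularity.Theorems.PowerGaugeEulerLiouville.ChiralAnchor

end
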